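import Literature.MathematicalPhysics.QuantumFieldTheory.Balaban1983to89.B15Eq177ValueInvariance
import Literature.MathematicalPhysics.QuantumFieldTheory.Balaban1983to89.Node00.LargeFieldBackgroundCoPOfRecord

/-!
# `Balaban1983to89.B15Eq177ValueInvarianceCoDiv` — T. Bałaban, *The variational problem and background fields in renormalization group method for
# lattice gauge theories*, Commun. Math. Phys. **102** (1985) 277–309 [Balaban1985Variational] = [15], p. 278 l. 8–9, verbatim: *«The space
# 𝔘_k({Ω_j}, ε₀) is gauge invariant»* — PROVED for the (1.9)-half (the covariant co-divergence clause `‖η·(D^{η*}_U ∂U)(b)‖ < δ`,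
# node00-def-P11's `Sect2.CoDivSmallOn`) and hence for NODE 00's FULL classes of record `regMSCoOfRecord` ∕ `regMSCoPOfRecord(At)` ([15] (2) =
# [6] (1.7) ∧ (1.9)); consequently [IV] p. 194's invariance of (1.77) holds at the backgrounds of record `bgMSCoOfRecord` ∕ `bgMSCoPOfRecord(At)`
# (the v1.5 `CoP` edition) by `B15Eq177ValueInvariance.fun177std_bgOfRecord_gaugeAct`

statement-level skeleton of published theorems with citation tags; proofs where landed; nothing here is a claim about the Yang–Mills mass gap

[6] = T. Bałaban, *Spaces of regular gauge field configurations on a lattice and gauge fixing conditions*, Commun. Math. Phys. **99** (1985) 75–102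
[Balaban1985RegularSpaces], (1.1)–(1.2) p. 76 (the covariant derivative `D^{η*}_U`), (1.9) p. 77; [IV] = [Balaban1989LargeFieldI], (1.77) p. 194.

WHY (cell `pub-ymgap`, seat dag-n12-c g6, LOCATED-181 companion).  `B15Eq177ValueInvariance` proves p. 194's value invariance of (1.77) at
`Node00.bgOfRecord av reg` for every gauge-invariant class `reg` and discharges `reg := regMSOfRecord` ([6] (1.7), plaquettes only).  NODE 00's record
classes since FILE 22∕22′ carry ALSO the (1.9) clause on the co-divergence `Sect2.coDivSum U x μ ∈ M_N(ℂ)` measured in the operator norm; its gauge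
invariance is the conjugation identity `coDivSum (U^w) x μ = w(x)·coDivSum U x μ·w(x)⁻¹` and the unitary invariance of the C⋆-norm.  This file supplies it.

WHAT IS CERTIFIED (kernel, sorry-free; axioms standard; every `SU(N)`).
* §1 `plaqMat_gaugeAct`, `gaugeAct_bond_unshift`, ★ `coDivTerm_gaugeAct`, ★ `coDivSum_gaugeAct` — [6] (1.1): `R(U(x,x−e_ν))F(x−e_ν) − F(x)` transforms
  by conjugation with `w(x)` (group bookkeeping in `M_N(ℂ)ˣ`); `coe_ιSU_mem_unitary`; ★ `norm_coDivSum_gaugeAct` (`‖w(x)·X·w(x)⁻¹‖ = ‖X‖`,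
  `CStarRing.norm_mem_unitary_mul` ∕ `norm_mul_mem_unitary`); ★★ `coDivSmallOn_gaugeAct_iff` — the (1.9) clause on ANY bond set is gauge invariant;
  `coDivClassOn_gaugeAct_iff`.
* §2 ★ `gaugeAct_mem_regMSCoOfRecord`, ★ `gaugeAct_mem_regMSCoPOfRecordAt`, `gaugeAct_mem_regMSCoPOfRecord` — [15] p. 278's sentence for NODE 00's
  full classes of record (FILE 22 `Co`, FILE 22′ `CoP` on a support ∕ on the support of record).
* §3 ★★ `fun177std_bgMSCoOfRecord_gaugeAct`, ★★ `fun177std_bgMSCoPOfRecordAt_gaugeAct`, ★★ `fun177std_bgMSCoPOfRecord_gaugeAct` — [IV] p. 194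
  *«The function is invariant with respect to the group of all gauge transformations defined on Λ»* for (1.77) AT THE BACKGROUNDS OF RECORD of the
  v1.4 `Co` and v1.5 `CoP` editions, every gauge transformation of `T^{(k′)}`, `k′ ≤ m + K` — the value-invariance letter `hf` of
  `B15Prop1LocalLettersOfFun` ∕ `B15Prop1IntrinsicOfFun` DISCHARGED there.

HONEST FRAMING: count-neutral bookkeeping of a printed one-line remark; nothing of [15] Thm 1 asserted; nothing continuum ∕ OS ∕ mass-gap ∕ Clay; N12 not
discharged.  No `def`, no instance, no notation, no `sorry`.
-/

noncomputable section

open scoped Matrix.Norms.L2Operator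

namespace Literature.MathematicalPhysics.QuantumFieldTheory.Balaban1983to89.B15Eq177ValueInvarianceCoDiv

open Literature.MathematicalPhysics.QuantumFieldTheory.Balaban1983to89
open GaugeField Node00 T4Continuum B15DeterminingSets B15Sect1Instances B15Eq177ValueInvariance

/-! ## §1  [6] (1.1)–(1.2), (1.9): the co-divergence transforms by conjugation; its operator norm is gauge invariant -/

section CoDiv

variable {P : Params} {j : ℕ} {N : ℕ} [NeZero N]

omit [NeZero N] in
/-- `(x − e_μ) + e_μ = x` on the torus (elementary). [cite: Balaban1985RegularSpaces, (1.1) p.76 (bookkeeping)] -/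
private theorem shift_unshift' (x : Site P j) (μ : Fin P.d) : (x.unshift μ).shift μ = x := by
  funext ν
  by_cases h : ν = μ
  · subst h; simp [Site.shift, Site.unshift]
  · simp [Site.shift, Site.unshift, Function.update_of_ne h]

/-- The embedded plaquette variable transforms by conjugation: `(∂U^w)(p(x)) = w(x)·(∂U)(p(x))·w(x)⁻¹` ([12] (9), `T4ReTrLipUnitary.plaqHol_gaugeAct`).
[cite: Balaban1985RegularSpaces, (1.2) p.76; Balaban1985Averaging, (9) p.19] -/
theorem plaqMat_gaugeAct (w : GaugeTransf P j (SU N)) (U : GaugeField P j (SU N)) (x : Site P j) (μ ν : Fin P.d) (h : μ < ν) :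
    Sect2.plaqMat (gaugeAct w U) x μ ν h =
      ((ιSU N (w x) : (MatA N)ˣ) : MatA N) * Sect2.plaqMat U x μ ν h * (((ιSU N (w x))⁻¹ : (MatA N)ˣ) : MatA N) := by
  unfold Sect2.plaqMat
  rw [T4ReTrLipUnitary.plaqHol_gaugeAct, map_mul, map_mul, map_inv, Units.val_mul, Units.val_mul]

/-- The transformed bond variable on the bond `⟨x − e_ν, x⟩`: `U^w(x−e_ν, x) = w(x−e_ν)·U(x−e_ν, x)·w(x)⁻¹`. [cite: Balaban1985Averaging, (8) p.19] -/
theorem gaugeAct_bond_unshift (w : GaugeTransf P j (SU N)) (U : GaugeField P j (SU N)) (x : Site P j) (ν : Fin P.d) :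
    gaugeAct w U ⟨x.unshift ν, ν⟩ = w (x.unshift ν) * U ⟨x.unshift ν, ν⟩ * (w x)⁻¹ := by
  show w _ * U _ * (w (PBond.tgt ⟨x.unshift ν, ν⟩))⁻¹ = _
  rw [show PBond.tgt (⟨x.unshift ν, ν⟩ : PBond P j) = x from shift_unshift' x ν]

/-- ★ **One term of [6] (1.2) transforms by conjugation with `w(x)`**: `R(U^w(x,x−e_ν))(∂U^w)(x−e_ν) − (∂U^w)(x) = w(x)·[R(U(x,x−e_ν))(∂U)(x−e_ν) −
(∂U)(x)]·w(x)⁻¹` (the parallel transport eats the `w(x−e_ν)` factors — group bookkeeping in `M_N(ℂ)ˣ`). [cite: Balaban1985RegularSpaces, (1.1)–(1.2) p.76] -/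
theorem coDivTerm_gaugeAct (w : GaugeTransf P j (SU N)) (U : GaugeField P j (SU N)) (x : Site P j) (ν α β : Fin P.d) (h : α < β) :
    Sect2.coDivTerm (gaugeAct w U) x ν α β h =
      ((ιSU N (w x) : (MatA N)ˣ) : MatA N) * Sect2.coDivTerm U x ν α β h * (((ιSU N (w x))⁻¹ : (MatA N)ˣ) : MatA N) := by
  unfold Sect2.coDivTerm
  rw [gaugeAct_bond_unshift, plaqMat_gaugeAct, plaqMat_gaugeAct]
  unfold Sect2.plaqMat
  simp only [map_mul, map_inv, ← Units.val_mul, mul_sub, sub_mul]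
  congr 1
  · congr 1; group

/-- ★ **The co-divergence `η·(D^{η*}_U ∂U)(x, x+e_μ)` transforms by conjugation with `w(x)`** (sum of §1's terms). [cite: Balaban1985RegularSpaces, (1.1)–(1.2) p.76, (1.9) p.77] -/
theorem coDivSum_gaugeAct (w : GaugeTransf P j (SU N)) (U : GaugeField P j (SU N)) (x : Site P j) (μ : Fin P.d) :
    Sect2.coDivSum (gaugeAct w U) x μ =
      ((ιSU N (w x) : (MatA N)ˣ) : MatA N) * Sect2.coDivSum U x μ * (((ιSU N (w x))⁻¹ : (MatA N)ˣ) : MatA N) := by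
  unfold Sect2.coDivSum
  rw [Finset.mul_sum, Finset.sum_mul]
  refine Finset.sum_congr rfl fun ν _ => ?_
  split_ifs with h1 h2
  · exact coDivTerm_gaugeAct w U x ν ν μ h1
  · rw [coDivTerm_gaugeAct, mul_neg, neg_mul]
  · rw [mul_zero, zero_mul]

omit [NeZero N] in
/-- The embedded `SU(N)` element is a unitary of `M_N(ℂ)`. [cite: Balaban1987RG1, pp.251–252 (bookkeeping)] -/
theorem coe_ιSU_mem_unitary (g : SU N) : ((ιSU N g : (MatA N)ˣ) : MatA N) ∈ unitary (MatA N) := by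
  rw [coe_ιSU]
  exact Matrix.specialUnitaryGroup_le_unitaryGroup g.prop

/-- ★ **The operator norm of the co-divergence is gauge invariant**: `|w(x)·X·w(x)⁻¹| = |X|` (unitary conjugation is a C⋆-norm isometry).
[cite: Balaban1985Variational, p.278; Balaban1985RegularSpaces, (1.9) p.77] -/
theorem norm_coDivSum_gaugeAct (w : GaugeTransf P j (SU N)) (U : GaugeField P j (SU N)) (x : Site P j) (μ : Fin P.d) :
    ‖Sect2.coDivSum (gaugeAct w U) x μ‖ = ‖Sect2.coDivSum U x μ‖ := by
  have h1 : ((ιSU N (w x) : (MatA N)ˣ) : MatA N) ∈ unitary (MatA N) := coe_ιSU_mem_unitary (w x)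
  have h2 : (((ιSU N (w x))⁻¹ : (MatA N)ˣ) : MatA N) ∈ unitary (MatA N) := by
    have e : (ιSU N (w x))⁻¹ = ιSU N (w x)⁻¹ := (map_inv (ιSU N) (w x)).symm
    rw [e]
    exact coe_ιSU_mem_unitary (w x)⁻¹
  rw [coDivSum_gaugeAct, mul_assoc, CStarRing.norm_mem_unitary_mul _ h1, CStarRing.norm_mul_mem_unitary _ h2]

/-- ★★ **THE (1.9) CLAUSE IS GAUGE INVARIANT** on any bond set `S` and threshold `δ` — [15] p. 278 *«The space 𝔘_k({Ω_j}, ε₀) is gauge invariant»*, the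
co-divergence half. [cite: Balaban1985Variational, p.278; Balaban1985RegularSpaces, (1.9) p.77] -/
theorem coDivSmallOn_gaugeAct_iff (S : Set (PBond P j)) (δ : ℝ) (w : GaugeTransf P j (SU N)) (U : GaugeField P j (SU N)) :
    Sect2.CoDivSmallOn S δ (gaugeAct w U) ↔ Sect2.CoDivSmallOn S δ U := by
  simp only [Sect2.CoDivSmallOn, norm_coDivSum_gaugeAct]

/-- The (1.9)-half `Sect2.CoDivClassOn Ω k ε` of the class `U_k({Ω_j}, ε)` is gauge invariant. [cite: Balaban1985Variational, (2) p.278] -/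
theorem coDivClassOn_gaugeAct_iff (Ω : ℕ → Set (Site P 0)) (k : ℕ) (ε : ℝ) (w : GaugeTransf P 0 (SU N)) (U : GaugeField P 0 (SU N)) :
    Sect2.CoDivClassOn Ω k ε (gaugeAct w U) ↔ Sect2.CoDivClassOn Ω k ε U := by
  simp only [Sect2.CoDivClassOn, coDivSmallOn_gaugeAct_iff]

end CoDiv

/-! ## §2  [15] p. 278 «The space 𝔘_k({Ω_j}, ε₀) is gauge invariant» for NODE 00's full classes of record -/

section Classes

variable {F : T4Family} {N : ℕ} [NeZero N]

/-- ★ FILE 22's class `regMSCoOfRecord` ([6] (1.7) ∧ (1.9), `Ω₀ = T_η`) is gauge invariant. [cite: Balaban1985Variational, (2) p.278] -/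
theorem gaugeAct_mem_regMSCoOfRecord (ν : Stage7Numerics) (K k : ℕ) (Ω : ℕ → Set (Site (F.P K) 0))
    (w : GaugeTransf (F.P K) 0 (SU N)) (U : GaugeField (F.P K) 0 (SU N)) (hU : U ∈ regMSCoOfRecord F N ν K k Ω) :
    gaugeAct w U ∈ regMSCoOfRecord F N ν K k Ω := by
  rw [mem_regMSCoOfRecord_iff] at hU ⊢
  exact ⟨gaugeAct_mem_regMSOfRecord ν K k Ω w U hU.1, (coDivClassOn_gaugeAct_iff _ _ _ w U).2 hU.2⟩

/-- ★ FILE 22′'s class on a support `Ω₀` (`regMSCoPOfRecordAt`, the v1.5 `CoP` edition) is gauge invariant. [cite: Balaban1985Variational, (2) p.278] -/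
theorem gaugeAct_mem_regMSCoPOfRecordAt (ν : Stage7Numerics) (K k : ℕ) (Ω₀ : Set (Site (F.P K) 0)) (Ω : ℕ → Set (Site (F.P K) 0))
    (w : GaugeTransf (F.P K) 0 (SU N)) (U : GaugeField (F.P K) 0 (SU N)) (hU : U ∈ regMSCoPOfRecordAt F N ν K k Ω₀ Ω) :
    gaugeAct w U ∈ regMSCoPOfRecordAt F N ν K k Ω₀ Ω := by
  rw [mem_regMSCoPOfRecordAt_iff] at hU ⊢
  exact ⟨fun j hj => (T4ReTrLipUnitary.plaqSmallOn_gaugeAct_iff _ _ w U).2 (hU.1 j hj),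
    fun j hj => (coDivSmallOn_gaugeAct_iff _ _ w U).2 (hU.2 j hj)⟩

/-- FILE 22′'s class of record (`regMSCoPOfRecord`, support `suppDomOfRecord`) is gauge invariant. [cite: Balaban1985Variational, (2) p.278] -/
theorem gaugeAct_mem_regMSCoPOfRecord (ν : Stage7Numerics) (K k : ℕ) (Ω : ℕ → Set (Site (F.P K) 0))
    (w : GaugeTransf (F.P K) 0 (SU N)) (U : GaugeField (F.P K) 0 (SU N)) (hU : U ∈ regMSCoPOfRecord F N ν K k Ω) :
    gaugeAct w U ∈ regMSCoPOfRecord F N ν K k Ω :=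
  gaugeAct_mem_regMSCoPOfRecordAt ν K k _ Ω w U hU

end Classes

/-! ## §3  [IV] p. 194's sentence at the backgrounds of record of the `Co` and `CoP` editions -/

section Record

variable {F : T4Family} {N : ℕ} [NeZero N]

/-- ★★ **(1.77) IS GAUGE INVARIANT AT `bgMSCoOfRecord F N ν K k Ω`** (FILE 22's background in print's full class): `A(U_{k′,Z}(V^u)) = A(U_{k′,Z}(V))`,
every `u` of `T^{(k′)}`, `k′ ≤ m + K`. [cite: Balaban1989LargeFieldI, (1.77) p.194] -/
theorem fun177std_bgMSCoOfRecord_gaugeAct (ν : Stage7Numerics) (K k : ℕ) (Ω : ℕ → Set (Site (F.P K) 0)) (M₁ : ℕ)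
    (Z : Set (Site (F.P K) 0)) {k' : ℕ} (hk' : k' ≤ (F.P K).m + (F.P K).K) (u : GaugeTransf (F.P K) k' (SU N))
    (Vk : GaugeField (F.P K) k' (SU N)) :
    fun177std (bgMSCoOfRecord F N ν K k Ω) M₁ Z k' (gaugeAct u Vk) = fun177std (bgMSCoOfRecord F N ν K k Ω) M₁ Z k' Vk :=
  fun177std_bgOfRecord_gaugeAct (avOfRecord F N K) (gaugeAct_mem_regMSCoOfRecord ν K k Ω) M₁ Z hk' u Vk

/-- ★★ **(1.77) IS GAUGE INVARIANT AT `bgMSCoPOfRecordAt F N ν K k Ω₀ Ω`** (FILE 22′'s background on a support). [cite: Balaban1989LargeFieldI, (1.77) p.194] -/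
theorem fun177std_bgMSCoPOfRecordAt_gaugeAct (ν : Stage7Numerics) (K k : ℕ) (Ω₀ : Set (Site (F.P K) 0)) (Ω : ℕ → Set (Site (F.P K) 0))
    (M₁ : ℕ) (Z : Set (Site (F.P K) 0)) {k' : ℕ} (hk' : k' ≤ (F.P K).m + (F.P K).K) (u : GaugeTransf (F.P K) k' (SU N))
    (Vk : GaugeField (F.P K) k' (SU N)) :
    fun177std (bgMSCoPOfRecordAt F N ν K k Ω₀ Ω) M₁ Z k' (gaugeAct u Vk) = fun177std (bgMSCoPOfRecordAt F N ν K k Ω₀ Ω) M₁ Z k' Vk :=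
  fun177std_bgOfRecord_gaugeAct (avOfRecord F N K) (gaugeAct_mem_regMSCoPOfRecordAt ν K k Ω₀ Ω) M₁ Z hk' u Vk

/-- ★★ **(1.77) IS GAUGE INVARIANT AT THE v1.5 BACKGROUND OF RECORD `bgMSCoPOfRecord F N ν K k Ω`** — the value-invariance letter `hf` of the repaired
N12∕s1 chain DISCHARGED at the background behind `Node00.UbgOfRecord₁₃CoP`. [cite: Balaban1989LargeFieldI, (1.77) p.194] -/
theorem fun177std_bgMSCoPOfRecord_gaugeAct (ν : Stage7Numerics) (K k : ℕ) (Ω : ℕ → Set (Site (F.P K) 0)) (M₁ : ℕ)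
    (Z : Set (Site (F.P K) 0)) {k' : ℕ} (hk' : k' ≤ (F.P K).m + (F.P K).K) (u : GaugeTransf (F.P K) k' (SU N))
    (Vk : GaugeField (F.P K) k' (SU N)) :
    fun177std (bgMSCoPOfRecord F N ν K k Ω) M₁ Z k' (gaugeAct u Vk) = fun177std (bgMSCoPOfRecord F N ν K k Ω) M₁ Z k' Vk :=
  fun177std_bgOfRecord_gaugeAct (avOfRecord F N K) (gaugeAct_mem_regMSCoPOfRecord ν K k Ω) M₁ Z hk' u Vk

end Record

end Literature.MathematicalPhysics.QuantumFieldTheory.Balaban1983to89.B15Eq177ValueInvarianceCoDiv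

end
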